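import Literature.MathematicalPhysics.QuantumFieldTheory.Balaban1983to89.B9Thm31SiteAgmonWeightY

/-!
# `Balaban1983to89.B9Thm31SiteLapGpDecayReg335Y` — T. Bałaban, *Propagators for lattice gauge theories in a background field*, Commun. Math. Phys. **99**
# (1985) 389–434 [Balaban1985BackgroundPropagators] Thm 3.1 (3.46) p. 398 (the `Δ_U G′(U)` entry) with (3.23)–(3.24) p. 394, by S. Agmon's method [Agmon1982]:
# ★★★ **THE `L²`-LOCAL DECAY OF `Δ_U G′(U)` OFF THE SOURCE** — on a site set `A` carrying no source and of levels `≥ j₁`, `Δ_U G′(U)Ψ = −K_a(U)G′(U)Ψ`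
# (the averaging term of (3.24)), so `Σ_{z∈A} HS((Δ_U G′(U)Ψ)(z)) ≤ (L^{j₁})⁻⁴·Σ_{w∈Ā} HS((G′(U)Ψ)(w)) ≤ 256·(L^{j₁})⁻⁴(L^{j_Ā})²(L^{j_B})²·W⁻²·‖Ψ‖²₁`
# — print's `‖hΔ_UG′(U)λ‖(Lʲη)² ≤ B₀(Lʲη)(Lʲ′η)e^{−δ₀d}‖h‖‖λ‖` shape (file 13 of the site-coercivity set of width seat `pub-ymgap-dag-n06-w1`)

statement-level skeleton of published theorems with citation tags; proofs where landed; nothing here is a claim about the Yang–Mills mass gap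

THE PRINT (p. 398, verbatim).  *«‖hG′(U)λ‖, ‖hζ∇_UG′(U)λ‖(Lʲη), ‖hG′(U)∇\*_Uζλ‖(Lʲη), ‖hΔ_UG′(U)λ‖(Lʲη)², … ≤ B₀(Lʲη)(Lʲ′η)e^{−δ₀d(y,y′)}‖h‖‖λ‖ for
supp h ⊂ Δ̃(y), y ∈ Λ_j, supp λ ⊂ Δ̃(y′); (3.46)»*; (3.24) p. 394: `Δ′_a(U) = Δ^η_U + Q′\*aQ′`, so off `supp λ`: `Δ^η_U G′λ = −Q′\*aQ′G′λ`.

WHY THIS FILE ∕ THE ARGUMENT.  def-Y's `deltaPrimeAY i par U = lapSL i U + kernelTrOpY (avgCoeffY i) (avgTrY i par U)` ((3.24): covariant Laplacian plus the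
transported averaging kernel `K_a`).  At `Φ = G′(U)Ψ`: `Δ_UΦ = Ψ − K_aΦ`, and on a site set `A` where `Ψ = 0`: `(Δ_UΦ)(z) = −(K_aΦ)(z)`.  The kernel `K_a` is
block-diagonal with nonnegative row sums `Σ_w a(z,w) ≤ (L^{lev z})⁻²` (file 5a) and unitary transporters, so by the weighted Cauchy–Schwarz
`HS((K_aΦ)(z)) ≤ (Σ_w a(z,w))·Σ_w a(z,w)HS(Φ w)` and `Σ_{z∈A}HS((K_aΦ)(z)) ≤ (L^{j₁})⁻⁴·Σ_{w∈Ā}HS(Φ w)` when the sites of `A` have level `≥ j₁` and `Ā`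
contains the blocks of `A`; files 6–7 bound the last sum.  Print's gain `(Lʲη)⁻²` for `Δ_UG′` relative to `G′` is exactly the row-sum factor.

WHAT IS PROVED (sorry-free; 0 `def`; nothing of [B9] asserted beyond what is proved).
* §1 `hs_wsum_R_le` (weighted Cauchy–Schwarz for `HS(Σ_w c_w·R(τ_w)X_w)`, `c ≥ 0`, unitary `τ`), `hs_kernelTrOpY_avg_le` (`HS((K_aΦ)(z)) ≤ m_z·Σ_w a(z,w)HS(Φ w)`),
  `sum_restrict_hs_kernelTrOpY_avg_le` (`Σ_{z∈A}HS((K_aΦ)(z)) ≤ (L^{j₁})⁻⁴·Σ_{w∈Ā}HS(Φ w)`), `lapSL_GpY_apply_of_zero` (`(Δ_UG′Ψ)(z) = −(K_aG′Ψ)(z)` where `Ψ z = 0`).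
* §2 ★★★ **`hs_restrict_lapSL_GpY_le`** (abstract weight; hypotheses of file 6 on `Ā, B` plus `Ψ = 0` on `A`, levels `≥ j₁` on `A`, `Ā ⊇` the blocks of `A`):
  `Σ_{z∈A} HS((Δ_UG′(U)Ψ)(z)) ≤ 256·((L^{j₁})⁻⁴(L^{j_Ā})²(L^{j_B})²∕W²)·‖Ψ‖²₁`, and ★★★ **`hs_restrict_lapSL_GpY_le_exp_canonical`** (`e^{δ₀ρ}`, `δ₀ = 1∕(4(d+2))`).
MODEL ∕ DECLARED READINGS.  As files 6–7; `Δ_U = lapSL i U` (def-Y's covariant Laplacian `Σ_μ ∇\*_{U,μ}∇_{U,μ}`, (3.23)); `A ∩ supp Ψ = ∅` is print's «supp h ⊂ Δ̃(y)»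
away from «supp λ ⊂ Δ̃(y′)» (for `y` near `y′` print's bound is `O(1)` and follows from `Δ_UG′ = I − K_aG′` with file 4 — not restated); for a single-level
region `j₁ = j_Ā = j` the constant reads `256·(L^{j_B}∕L^{j})²`, print's `(B₀Lʲ′η∕Lʲη)²`.  NOT HERE: (3.42)–(3.45), (3.47), the bond sector.
HONEST SCOPE.  A decay estimate for one finite lattice operator at a time; NOT a node discharge, NOT summit progress; count-neutral; nothing continuum ∕ OS ∕ mass
gap ∕ Clay.  NEW file importing file 7 only; nothing landed is modified.  Net new unproved facts: 0.
-/

noncomputable section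

namespace Literature.MathematicalPhysics.QuantumFieldTheory.Balaban1983to89.B9Thm31SiteLapGpDecayReg335Y

open Literature.MathematicalPhysics.QuantumFieldTheory.Balaban1983to89
open Node00 B6KLevelCensusIndexV1 B6Geom246MultiLevelBox B6MultiLevelBoxOperator B6MultiLevelTorusOperator B6GlobalChartV1 B9BackgroundsKLevelV1
  B9Eq39Adjoint B9Thm311ReadingCoords B9Thm311DeltaPrimePos B9Ineq369CurvatureSmallAtLettersY B9Thm31SiteCoerciveGaugeBlockY
  B9Thm31SiteCoerciveReg335Y B9Thm31SiteGpBoundsReg335Y B9Thm31SitePolarisedFormY B9Thm31SiteConjugatedFormY B9Thm31SiteGpDecayReg335Y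
  B9Thm31SiteAgmonWeightY
open Literature.MathematicalPhysics.QuantumFieldTheory.Balaban1983to89.B9Thm311DeltaPrimeSymm (avgCoeffY_eq_ite avgCoeffY_symm)
open Literature.MathematicalPhysics.QuantumFieldTheory.Balaban1983to89.B9Thm37CubeCoverCommutatorSizes (avgCoeffY_nonneg)
open scoped Matrix Matrix.Norms.L2Operator

/-! ## §1 The averaging kernel in `HS`: weighted Cauchy–Schwarz and row sums -/

section Kernel

variable {N : ℕ}

/-- WEIGHTED CAUCHY–SCHWARZ FOR A TRANSPORTED SUM: `HS(Σ_{w∈S} c_w·R(τ_w)X_w) ≤ (Σ_w c_w)·Σ_w c_w·HS(X_w)` for `c ≥ 0` and contraction pairs `τ_w`.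
[cite: Balaban1984PropagatorsII, (2.147) p.248, bookkeeping] -/
theorem hs_wsum_R_le {ι : Type} (S : Finset ι) (c : ι → ℝ) (hc : ∀ w, 0 ≤ c w) (τ : ι → (Matrix (Fin N) (Fin N) ℂ)ˣ)
    (hτ : ∀ w, ‖(τ w : Matrix (Fin N) (Fin N) ℂ)‖ ≤ 1 ∧ ‖(((τ w)⁻¹ : (Matrix (Fin N) (Fin N) ℂ)ˣ) : Matrix (Fin N) (Fin N) ℂ)‖ ≤ 1)
    (X : ι → Matrix (Fin N) (Fin N) ℂ) :
    ∑ a, ∑ b, ‖(∑ w ∈ S, ((c w : ℝ) : ℂ) • R (τ w) (X w)) a b‖ ^ 2 ≤ (∑ w ∈ S, c w) * ∑ w ∈ S, c w * ∑ a, ∑ b, ‖X w a b‖ ^ 2 := by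
  -- entrywise: `|Σ c_w y_w| ≤ Σ c_w|y_w|`, `(Σ √c·√c|y|)² ≤ (Σ c)(Σ c|y|²)`
  have hentry : ∀ a b, ‖(∑ w ∈ S, ((c w : ℝ) : ℂ) • R (τ w) (X w)) a b‖ ^ 2 ≤ (∑ w ∈ S, c w) * ∑ w ∈ S, c w * ‖R (τ w) (X w) a b‖ ^ 2 := by
    intro a b
    rw [Matrix.sum_apply]
    have h1 : ‖∑ w ∈ S, (((c w : ℝ) : ℂ) • R (τ w) (X w)) a b‖ ≤ ∑ w ∈ S, c w * ‖R (τ w) (X w) a b‖ := by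
      refine (norm_sum_le _ _).trans (Finset.sum_le_sum fun w _ => ?_)
      rw [Matrix.smul_apply, norm_smul, Complex.norm_real, Real.norm_eq_abs, abs_of_nonneg (hc w)]
    have h2 : (∑ w ∈ S, c w * ‖R (τ w) (X w) a b‖) ^ 2 ≤ (∑ w ∈ S, c w) * ∑ w ∈ S, c w * ‖R (τ w) (X w) a b‖ ^ 2 := by
      have h := Finset.sum_mul_sq_le_sq_mul_sq S (fun w => Real.sqrt (c w)) (fun w => Real.sqrt (c w) * ‖R (τ w) (X w) a b‖)
      have e1 : ∀ w ∈ S, Real.sqrt (c w) * (Real.sqrt (c w) * ‖R (τ w) (X w) a b‖) = c w * ‖R (τ w) (X w) a b‖ := fun w _ => by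
        rw [← mul_assoc, Real.mul_self_sqrt (hc w)]
      have e2 : ∀ w ∈ S, Real.sqrt (c w) ^ 2 = c w := fun w _ => Real.sq_sqrt (hc w)
      have e3 : ∀ w ∈ S, (Real.sqrt (c w) * ‖R (τ w) (X w) a b‖) ^ 2 = c w * ‖R (τ w) (X w) a b‖ ^ 2 := fun w _ => by
        rw [mul_pow, Real.sq_sqrt (hc w)]
      rw [Finset.sum_congr rfl e1, Finset.sum_congr rfl e2, Finset.sum_congr rfl e3] at h
      exact h
    exact (pow_le_pow_left₀ (norm_nonneg _) h1 2).trans h2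
  have e : (∑ w ∈ S, c w) * ∑ w ∈ S, c w * ∑ a, ∑ b, ‖R (τ w) (X w) a b‖ ^ 2
      = ∑ a, ∑ b, (∑ w ∈ S, c w) * ∑ w ∈ S, c w * ‖R (τ w) (X w) a b‖ ^ 2 := by
    rw [Finset.mul_sum]
    have hw : ∀ w ∈ S, (∑ w ∈ S, c w) * (c w * ∑ a, ∑ b, ‖R (τ w) (X w) a b‖ ^ 2)
        = ∑ a, ∑ b, (∑ w ∈ S, c w) * (c w * ‖R (τ w) (X w) a b‖ ^ 2) := fun w _ => by
      rw [Finset.mul_sum, Finset.mul_sum]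
      refine Finset.sum_congr rfl fun a _ => ?_
      rw [Finset.mul_sum, Finset.mul_sum]
    rw [Finset.sum_congr rfl hw, Finset.sum_comm]
    refine Finset.sum_congr rfl fun a _ => ?_
    rw [Finset.sum_comm]
    refine Finset.sum_congr rfl fun b _ => ?_
    rw [Finset.mul_sum]
  calc ∑ a, ∑ b, ‖(∑ w ∈ S, ((c w : ℝ) : ℂ) • R (τ w) (X w)) a b‖ ^ 2
      ≤ ∑ a, ∑ b, (∑ w ∈ S, c w) * ∑ w ∈ S, c w * ‖R (τ w) (X w) a b‖ ^ 2 := Finset.sum_le_sum fun a _ => Finset.sum_le_sum fun b _ => hentry a b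
    _ = (∑ w ∈ S, c w) * ∑ w ∈ S, c w * ∑ a, ∑ b, ‖R (τ w) (X w) a b‖ ^ 2 := e.symm
    _ ≤ (∑ w ∈ S, c w) * ∑ w ∈ S, c w * ∑ a, ∑ b, ‖X w a b‖ ^ 2 :=
        mul_le_mul_of_nonneg_left (Finset.sum_le_sum fun w _ => mul_le_mul_of_nonneg_left (hs_R_le (hτ w) (X w)) (hc w)) (Finset.sum_nonneg fun w _ => hc w)

end Kernel

section Lattice

variable {d ℓ : ℕ} {hd : 1 ≤ d + 1} {hL : Odd (ℓ + 1) ∧ 1 < ℓ + 1} {b₀ b₁ : ℝ}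
variable (i : KIdx d ℓ hd hL b₀ b₁) {N : ℕ} {G : Subgroup (Matrix (Fin N) (Fin N) ℂ)ˣ}

/-- THE AVERAGING KERNEL IN `HS`: `HS((K_a(U)Φ)(z)) ≤ (L^{lev z})⁻²·Σ_w a(z,w)·HS(Φ w)` for a `G`-valued table, `G ≤ U(N)`.
[cite: Balaban1985BackgroundPropagators, (3.24) p.394; Balaban1984PropagatorsII, (2.14) p.225] -/
theorem hs_kernelTrOpY_avg_le (hG : G ≤ B7Prop2Explicit.unitaryUnits (Matrix (Fin N) (Fin N) ℂ)) (par : SiteParY (Matrix (Fin N) (Fin N) ℂ) i)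
    (U : CfgY (Matrix (Fin N) (Fin N) ℂ) i) (hpar : ∀ z w : SiteY i, par U z w ∈ G) (Φ : SiteY i → Matrix (Fin N) (Fin N) ℂ) (z : SiteY i) :
    ∑ a, ∑ b, ‖kernelTrOpY (avgCoeffY i) (avgTrY i par U) Φ z a b‖ ^ 2
      ≤ (((((ℓ + 1) ^ (blkOf i.D.toDomains z).1.1 : ℕ) : ℝ)) ^ 2)⁻¹ * ∑ w, avgCoeffY i z w * ∑ a, ∑ b, ‖Φ w a b‖ ^ 2 := by
  rw [kernelTrOpY_apply]
  have hτ : ∀ w, ‖(avgTrY i par U z w : Matrix (Fin N) (Fin N) ℂ)‖ ≤ 1 ∧ ‖(((avgTrY i par U z w)⁻¹ : (Matrix (Fin N) (Fin N) ℂ)ˣ) : Matrix (Fin N) (Fin N) ℂ)‖ ≤ 1 :=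
    fun w => contractive_of_mem_unitary (V := avgTrY i par U z w) (hG (G.mul_mem (hpar _ _) (hpar _ _)))
  have h := hs_wsum_R_le Finset.univ (avgCoeffY i z) (avgCoeffY_nonneg i z) (avgTrY i par U z) hτ Φ
  exact h.trans (mul_le_mul_of_nonneg_right (sum_avgCoeffY_le i z) (Finset.sum_nonneg fun w _ => mul_nonneg (avgCoeffY_nonneg i z w) (hs_nonneg _)))

/-- RESTRICTED TO A SITE SET `A` OF LEVELS `≥ j₁` WHOSE BLOCKS LIE IN `Ā`: `Σ_{z∈A}HS((K_a(U)Φ)(z)) ≤ (L^{j₁})⁻⁴·Σ_{w∈Ā}HS(Φ w)` (row sums and column sums of `a`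
are `≤ (L^{lev})⁻²`, `a` is supported on pairs in one block). [cite: Balaban1985BackgroundPropagators, (3.24) p.394; Balaban1984PropagatorsII, (2.14) p.225] -/
theorem sum_restrict_hs_kernelTrOpY_avg_le (hG : G ≤ B7Prop2Explicit.unitaryUnits (Matrix (Fin N) (Fin N) ℂ)) (par : SiteParY (Matrix (Fin N) (Fin N) ℂ) i)
    (U : CfgY (Matrix (Fin N) (Fin N) ℂ) i) (hpar : ∀ z w : SiteY i, par U z w ∈ G) (Φ : SiteY i → Matrix (Fin N) (Fin N) ℂ)
    {A Abar : Finset (SiteY i)} (hĀ : ∀ z ∈ A, ∀ w, blkOf i.D.toDomains w = blkOf i.D.toDomains z → w ∈ Abar)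
    {j₁ : ℕ} (hj₁ : ∀ z ∈ A, j₁ ≤ (blkOf i.D.toDomains z).1.1) :
    ∑ z ∈ A, ∑ a, ∑ b, ‖kernelTrOpY (avgCoeffY i) (avgTrY i par U) Φ z a b‖ ^ 2
      ≤ ((((((ℓ + 1) ^ j₁ : ℕ) : ℝ)) ^ 2)⁻¹) ^ 2 * ∑ w ∈ Abar, ∑ a, ∑ b, ‖Φ w a b‖ ^ 2 := by
  classical
  set m₁ : ℝ := (((((ℓ + 1) ^ j₁ : ℕ) : ℝ)) ^ 2)⁻¹ with hm₁
  have hm₁0 : 0 ≤ m₁ := inv_nonneg.2 (by positivity)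
  -- the local mass on `A` (and on the blocks of `A`) is `≤ m₁`
  have hmle : ∀ z, j₁ ≤ (blkOf i.D.toDomains z).1.1 → (((((ℓ + 1) ^ (blkOf i.D.toDomains z).1.1 : ℕ) : ℝ)) ^ 2)⁻¹ ≤ m₁ := fun z hz => by
    have hpow : (((ℓ + 1) ^ j₁ : ℕ) : ℝ) ≤ (((ℓ + 1) ^ (blkOf i.D.toDomains z).1.1 : ℕ) : ℝ) := by exact_mod_cast Nat.pow_le_pow_right (Nat.succ_pos ℓ) hz
    exact inv_anti₀ (by positivity) (pow_le_pow_left₀ (by positivity) hpow 2)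
  -- step 1: per site of `A`
  have h1 : ∑ z ∈ A, ∑ a, ∑ b, ‖kernelTrOpY (avgCoeffY i) (avgTrY i par U) Φ z a b‖ ^ 2
      ≤ ∑ z ∈ A, m₁ * ∑ w, avgCoeffY i z w * ∑ a, ∑ b, ‖Φ w a b‖ ^ 2 := by
    refine Finset.sum_le_sum fun z hz => (hs_kernelTrOpY_avg_le i hG par U hpar Φ z).trans ?_
    exact mul_le_mul_of_nonneg_right (hmle z (hj₁ z hz)) (Finset.sum_nonneg fun w _ => mul_nonneg (avgCoeffY_nonneg i z w) (hs_nonneg _))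
  -- step 2: exchange the sums; the column sums over `A` are `≤ m_w ≤ m₁` and vanish off `Ā`
  have h2 : ∑ z ∈ A, ∑ w, avgCoeffY i z w * ∑ a, ∑ b, ‖Φ w a b‖ ^ 2 = ∑ w, (∑ z ∈ A, avgCoeffY i z w) * ∑ a, ∑ b, ‖Φ w a b‖ ^ 2 := by
    rw [Finset.sum_comm]; exact Finset.sum_congr rfl fun w _ => by rw [Finset.sum_mul]
  have hcol : ∀ w, (∑ z ∈ A, avgCoeffY i z w) * ∑ a, ∑ b, ‖Φ w a b‖ ^ 2 ≤ (if w ∈ Abar then m₁ else 0) * ∑ a, ∑ b, ‖Φ w a b‖ ^ 2 := by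
    intro w
    refine mul_le_mul_of_nonneg_right ?_ (hs_nonneg _)
    by_cases hw : w ∈ Abar
    · rw [if_pos hw]
      -- `Σ_{z∈A} a(z,w) ≤ Σ_z a(w,z) ≤ m_w ≤ m₁` when some `z ∈ A` shares the block of `w`; else the sum is `0 ≤ m₁`
      by_cases hex : ∃ z ∈ A, blkOf i.D.toDomains w = blkOf i.D.toDomains z
      · obtain ⟨z₀, hz₀, hbz⟩ := hex
        have hlev : j₁ ≤ (blkOf i.D.toDomains w).1.1 := by rw [hbz]; exact hj₁ z₀ hz₀
        calc ∑ z ∈ A, avgCoeffY i z w ≤ ∑ z, avgCoeffY i z w :=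
              Finset.sum_le_univ_sum_of_nonneg fun z => avgCoeffY_nonneg i z w
          _ = ∑ z, avgCoeffY i w z := Finset.sum_congr rfl fun z _ => avgCoeffY_symm i z w
          _ ≤ _ := sum_avgCoeffY_le i w
          _ ≤ m₁ := hmle w hlev
      · have h0 : ∑ z ∈ A, avgCoeffY i z w = 0 := Finset.sum_eq_zero fun z hz => by
          rw [avgCoeffY_eq_ite, if_neg (fun h => hex ⟨z, hz, h⟩)]
        rw [h0]; exact hm₁0
    · rw [if_neg hw]
      have h0 : ∑ z ∈ A, avgCoeffY i z w = 0 := Finset.sum_eq_zero fun z hz => by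
        rw [avgCoeffY_eq_ite]
        by_cases hb : blkOf i.D.toDomains w = blkOf i.D.toDomains z
        · exact absurd (hĀ z hz w hb) hw
        · rw [if_neg hb]
      rw [h0]
  have h3 : ∑ w, (if w ∈ Abar then m₁ else 0) * ∑ a, ∑ b, ‖Φ w a b‖ ^ 2 = m₁ * ∑ w ∈ Abar, ∑ a, ∑ b, ‖Φ w a b‖ ^ 2 := by
    rw [Finset.mul_sum, ← Finset.sum_filter_add_sum_filter_not Finset.univ (fun w => w ∈ Abar)]
    have hz : ∑ w ∈ Finset.univ.filter (fun w => ¬ w ∈ Abar), (if w ∈ Abar then m₁ else 0) * ∑ a, ∑ b, ‖Φ w a b‖ ^ 2 = 0 :=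
      Finset.sum_eq_zero fun w hw => by rw [if_neg (Finset.mem_filter.1 hw).2, zero_mul]
    rw [hz, add_zero, Finset.filter_mem_eq_inter, Finset.univ_inter]
    exact Finset.sum_congr rfl fun w hw => by rw [if_pos hw]
  calc ∑ z ∈ A, ∑ a, ∑ b, ‖kernelTrOpY (avgCoeffY i) (avgTrY i par U) Φ z a b‖ ^ 2
      ≤ ∑ z ∈ A, m₁ * ∑ w, avgCoeffY i z w * ∑ a, ∑ b, ‖Φ w a b‖ ^ 2 := h1
    _ = m₁ * ∑ w, (∑ z ∈ A, avgCoeffY i z w) * ∑ a, ∑ b, ‖Φ w a b‖ ^ 2 := by rw [← Finset.mul_sum, h2]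
    _ ≤ m₁ * ∑ w, (if w ∈ Abar then m₁ else 0) * ∑ a, ∑ b, ‖Φ w a b‖ ^ 2 := mul_le_mul_of_nonneg_left (Finset.sum_le_sum fun w _ => hcol w) hm₁0
    _ = m₁ ^ 2 * ∑ w ∈ Abar, ∑ a, ∑ b, ‖Φ w a b‖ ^ 2 := by rw [h3]; ring

/-- OFF THE SOURCE, `Δ_U G′(U)Ψ` IS MINUS THE AVERAGING TERM: at a site `z` with `Ψ z = 0`, `(Δ_U G′(U)Ψ)(z) = −(K_a(U)G′(U)Ψ)(z)` (`G`-valued `U`, `G ≤ U(N)`;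
`Δ′_a = Δ_U + K_a`, `Δ′_aG′ = I`). [cite: Balaban1985BackgroundPropagators, (3.24) p.394, (3.25) p.394] -/
theorem lapSL_GpY_apply_of_zero (hG : G ≤ B7Prop2Explicit.unitaryUnits (Matrix (Fin N) (Fin N) ℂ)) {U : CfgY (Matrix (Fin N) (Fin N) ℂ) i}
    (hU : ∀ μ x, U μ x ∈ G) (Ψ : SiteY i → Matrix (Fin N) (Fin N) ℂ) {z : SiteY i} (hz : Ψ z = 0) :
    lapSL i U (GpY i (parSymY i) U Ψ) z = -(kernelTrOpY (avgCoeffY i) (avgTrY i (parSymY i) U) (GpY i (parSymY i) U Ψ) z) := by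
  have hunit : IsUnit (deltaPrimeAY i (parSymY i) U) := isUnit_deltaPrimeAY_parSymY i hG hU
  have hΔΦ : deltaPrimeAY i (parSymY i) U (GpY i (parSymY i) U Ψ) = Ψ := apply_inverse_of_isUnit hunit Ψ
  have h := congrFun hΔΦ z
  rw [deltaPrimeAY, LinearMap.add_apply, Pi.add_apply, hz] at h
  exact eq_neg_of_add_eq_zero_left h

end Lattice

/-! ## §2 (3.46d): the decay of `Δ_U G′(U)` off the source -/

section Main

variable {d ℓ : ℕ} {hd : 1 ≤ d + 1} {hL : Odd (ℓ + 1) ∧ 1 < ℓ + 1} {b₀ b₁ : ℝ}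
variable (i : KIdx d ℓ hd hL b₀ b₁) {N : ℕ} {G : Subgroup (Matrix (Fin N) (Fin N) ℂ)ˣ}

/-- ★★★ **THE `L²`-LOCAL DECAY OF `Δ_U G′(U)` OFF THE SOURCE ON THE CLASS (3.35)** — (3.46d)'s shape by Agmon's method.  Class hypotheses and an admissible
weight `ω` as in file 6 (`ω = 1` on `B ⊇ supp Ψ`, `ω ≥ W > 0` on `Ā`, bond ratios, block oscillation, `(d+1)θ_b + θ_s∕2 ≤ 1∕16`, levels `≤ j_Ā` on `Ā`, `≤ j_B`
on `B`); a site set `A` with `Ψ = 0` on `A`, levels `≥ j₁` on `A`, and `Ā ⊇` every block meeting `A`.  THEN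
`Σ_{z∈A} HS((Δ_U G′(U)Ψ)(z)) ≤ 256·((L^{j₁})⁻⁴·(L^{j_Ā})²(L^{j_B})²∕W²)·‖Ψ‖²₁` (single-level region: `256·(L^{j_B}∕L^{j})²·W⁻²`).
[cite: Balaban1985BackgroundPropagators, Thm 3.1 (3.46) p.398, (3.24) p.394, (3.35) p.396; Agmon1982, Ch.1, Thm 1.5] -/
theorem hs_restrict_lapSL_GpY_le [Nonempty (Fin N)] (hG : G ≤ B7Prop2Explicit.unitaryUnits (Matrix (Fin N) (Fin N) ℂ))
    {U : CfgY (Matrix (Fin N) (Fin N) ℂ) i} {c α₀ : ℝ} (hC0 : 0 ≤ c * (kGeo i).M * α₀) (hC1 : c * (kGeo i).M * α₀ * ((d : ℝ) + 1) ≤ 1 / 16)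
    (hreg : (bg9K (Matrix (Fin N) (Fin N) ℂ) G i).Reg335 c α₀ U) {ω : SiteY i → ℝ} (hω : ∀ z, 0 < ω z) {θb θs : ℝ}
    (hb1 : ∀ μ z, ω (shiftY i μ z) / ω z + ω z / ω (shiftY i μ z) - 2 ≤ θb * (((((ℓ + 1) ^ (blkOf i.D.toDomains z).1.1 : ℕ) : ℝ)) ^ 2)⁻¹)
    (hb2 : ∀ μ z, ω (shiftY i μ z) / ω z + ω z / ω (shiftY i μ z) - 2 ≤ θb * (((((ℓ + 1) ^ (blkOf i.D.toDomains (shiftY i μ z)).1.1 : ℕ) : ℝ)) ^ 2)⁻¹)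
    (hs : ∀ z w : SiteY i, blkOf i.D.toDomains w = blkOf i.D.toDomains z → ω z / ω w + ω w / ω z - 2 ≤ θs)
    (hκ : ((d : ℝ) + 1) * θb + θs / 2 ≤ 1 / 16)
    {A Abar B : Finset (SiteY i)} {Ψ : SiteY i → Matrix (Fin N) (Fin N) ℂ} (hΨ : ∀ z, z ∉ B → Ψ z = 0) (hΨA : ∀ z ∈ A, Ψ z = 0) (hωB : ∀ z ∈ B, ω z = 1)
    (hĀ : ∀ z ∈ A, ∀ w, blkOf i.D.toDomains w = blkOf i.D.toDomains z → w ∈ Abar) {j₁ jA jB : ℕ} (hj₁ : ∀ z ∈ A, j₁ ≤ (blkOf i.D.toDomains z).1.1)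
    (hjA : ∀ z ∈ Abar, (blkOf i.D.toDomains z).1.1 ≤ jA) (hjB : ∀ z ∈ B, (blkOf i.D.toDomains z).1.1 ≤ jB) {W : ℝ} (hW0 : 0 < W) (hW : ∀ z ∈ Abar, W ≤ ω z) :
    ∑ z ∈ A, ∑ a, ∑ b, ‖lapSL i U (GpY i (parSymY i) U Ψ) z a b‖ ^ 2
      ≤ 256 * (((((((ℓ + 1) ^ j₁ : ℕ) : ℝ)) ^ 2)⁻¹) ^ 2 *
          (((((ℓ + 1) ^ jA : ℕ) : ℝ)) ^ 2 * ((((ℓ + 1) ^ jB : ℕ) : ℝ)) ^ 2 / W ^ 2)) * trIP (fun _ => (1 : ℝ)) Ψ Ψ := by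
  have hU : ∀ μ x, U μ x ∈ G := hreg.1
  -- off the source, `Δ_U G′Ψ = −K_a G′Ψ`
  have h0 : ∑ z ∈ A, ∑ a, ∑ b, ‖lapSL i U (GpY i (parSymY i) U Ψ) z a b‖ ^ 2
      = ∑ z ∈ A, ∑ a, ∑ b, ‖kernelTrOpY (avgCoeffY i) (avgTrY i (parSymY i) U) (GpY i (parSymY i) U Ψ) z a b‖ ^ 2 := by
    refine Finset.sum_congr rfl fun z hz => ?_
    rw [lapSL_GpY_apply_of_zero i hG hU Ψ (hΨA z hz)]
    simp only [Matrix.neg_apply, norm_neg]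
  have h1 := sum_restrict_hs_kernelTrOpY_avg_le i hG (parSymY i) U (fun z w => parSymY_mem i hU z w) (GpY i (parSymY i) U Ψ) hĀ hj₁
  have h2 := hs_restrict_GpY_parSymY_le i hG hC0 hC1 hreg hω hb1 hb2 hs hκ hΨ hωB hjA hjB hW0 hW
  have hm : (0 : ℝ) ≤ ((((((ℓ + 1) ^ j₁ : ℕ) : ℝ)) ^ 2)⁻¹) ^ 2 := sq_nonneg _
  rw [h0]
  calc ∑ z ∈ A, ∑ a, ∑ b, ‖kernelTrOpY (avgCoeffY i) (avgTrY i (parSymY i) U) (GpY i (parSymY i) U Ψ) z a b‖ ^ 2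
      ≤ ((((((ℓ + 1) ^ j₁ : ℕ) : ℝ)) ^ 2)⁻¹) ^ 2 * ∑ w ∈ Abar, ∑ a, ∑ b, ‖GpY i (parSymY i) U Ψ w a b‖ ^ 2 := h1
    _ ≤ ((((((ℓ + 1) ^ j₁ : ℕ) : ℝ)) ^ 2)⁻¹) ^ 2 *
        (256 * (((((ℓ + 1) ^ jA : ℕ) : ℝ)) ^ 2 * ((((ℓ + 1) ^ jB : ℕ) : ℝ)) ^ 2 / W ^ 2) * trIP (fun _ => (1 : ℝ)) Ψ Ψ) := mul_le_mul_of_nonneg_left h2 hm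
    _ = _ := by ring

/-- ★★★ **(3.46d) WITH THE CANONICAL AGMON WEIGHT** `e^{δ₀ρ}`, `δ₀ = 1∕(4(d+2))` (`ρ` bond-Lipschitz at scale `(L^{lev})⁻¹`, block oscillation `≤ d+1`, `ρ = 0` on `B`,
`ρ ≥ r` on `Ā`): `Σ_{z∈A} HS((Δ_U G′(U)Ψ)(z)) ≤ 256·((L^{j₁})⁻⁴(L^{j_Ā})²(L^{j_B})²∕(e^{δ₀r})²)·‖Ψ‖²₁`.
[cite: Balaban1985BackgroundPropagators, Thm 3.1 (3.46) p.398; Agmon1982, Ch.1, Thm 1.5] -/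
theorem hs_restrict_lapSL_GpY_le_exp_canonical [Nonempty (Fin N)] (hG : G ≤ B7Prop2Explicit.unitaryUnits (Matrix (Fin N) (Fin N) ℂ))
    {U : CfgY (Matrix (Fin N) (Fin N) ℂ) i} {c α₀ : ℝ} (hC0 : 0 ≤ c * (kGeo i).M * α₀) (hC1 : c * (kGeo i).M * α₀ * ((d : ℝ) + 1) ≤ 1 / 16)
    (hreg : (bg9K (Matrix (Fin N) (Fin N) ℂ) G i).Reg335 c α₀ U) {ρ : SiteY i → ℝ}
    (hρ1 : ∀ μ z, |ρ (shiftY i μ z) - ρ z| ≤ ((((ℓ + 1) ^ (blkOf i.D.toDomains z).1.1 : ℕ) : ℝ))⁻¹)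
    (hρ2 : ∀ μ z, |ρ (shiftY i μ z) - ρ z| ≤ ((((ℓ + 1) ^ (blkOf i.D.toDomains (shiftY i μ z)).1.1 : ℕ) : ℝ))⁻¹)
    (hρD : ∀ z w : SiteY i, blkOf i.D.toDomains w = blkOf i.D.toDomains z → |ρ z - ρ w| ≤ (d : ℝ) + 1)
    {A Abar B : Finset (SiteY i)} {Ψ : SiteY i → Matrix (Fin N) (Fin N) ℂ} (hΨ : ∀ z, z ∉ B → Ψ z = 0) (hΨA : ∀ z ∈ A, Ψ z = 0) (hρB : ∀ z ∈ B, ρ z = 0)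
    (hĀ : ∀ z ∈ A, ∀ w, blkOf i.D.toDomains w = blkOf i.D.toDomains z → w ∈ Abar) {j₁ jA jB : ℕ} (hj₁ : ∀ z ∈ A, j₁ ≤ (blkOf i.D.toDomains z).1.1)
    (hjA : ∀ z ∈ Abar, (blkOf i.D.toDomains z).1.1 ≤ jA) (hjB : ∀ z ∈ B, (blkOf i.D.toDomains z).1.1 ≤ jB) {r : ℝ} (hr : ∀ z ∈ Abar, r ≤ ρ z) :
    ∑ z ∈ A, ∑ a, ∑ b, ‖lapSL i U (GpY i (parSymY i) U Ψ) z a b‖ ^ 2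
      ≤ 256 * (((((((ℓ + 1) ^ j₁ : ℕ) : ℝ)) ^ 2)⁻¹) ^ 2 *
          (((((ℓ + 1) ^ jA : ℕ) : ℝ)) ^ 2 * ((((ℓ + 1) ^ jB : ℕ) : ℝ)) ^ 2 / Real.exp ((1 / (4 * ((d : ℝ) + 2))) * r) ^ 2)) * trIP (fun _ => (1 : ℝ)) Ψ Ψ := by
  have hd0 : (0 : ℝ) ≤ d := Nat.cast_nonneg d
  have hd2 : (0 : ℝ) < 4 * ((d : ℝ) + 2) := by positivity
  have hδ0 : (0 : ℝ) ≤ 1 / (4 * ((d : ℝ) + 2)) := by positivity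
  have hδ1 : 1 / (4 * ((d : ℝ) + 2)) ≤ 1 := by rw [div_le_one hd2]; linarith
  have hδD : 1 / (4 * ((d : ℝ) + 2)) * ((d : ℝ) + 1) ≤ 1 := by
    rw [div_mul_eq_mul_div, one_mul, div_le_one hd2]; linarith
  have hδκ0 : (1 / (4 * ((d : ℝ) + 2))) ^ 2 * (2 * ((d : ℝ) + 1) + ((d : ℝ) + 1) ^ 2) ≤ 1 / 16 := by
    rw [div_pow, one_pow, mul_pow, one_div_mul_eq_div, div_le_iff₀ (by positivity)]
    nlinarith
  have hδκ : ((d : ℝ) + 1) * (2 * (1 / (4 * ((d : ℝ) + 2))) ^ 2) + (2 * (1 / (4 * ((d : ℝ) + 2))) ^ 2 * ((d : ℝ) + 1) ^ 2) / 2 ≤ 1 / 16 := by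
    have e : ((d : ℝ) + 1) * (2 * (1 / (4 * ((d : ℝ) + 2))) ^ 2) + (2 * (1 / (4 * ((d : ℝ) + 2))) ^ 2 * ((d : ℝ) + 1) ^ 2) / 2
        = (1 / (4 * ((d : ℝ) + 2))) ^ 2 * (2 * ((d : ℝ) + 1) + ((d : ℝ) + 1) ^ 2) := by ring
    rw [e]; exact hδκ0
  have hω : ∀ z, 0 < Real.exp (1 / (4 * ((d : ℝ) + 2)) * ρ z) := fun z => Real.exp_pos _
  have hωB : ∀ z ∈ B, Real.exp (1 / (4 * ((d : ℝ) + 2)) * ρ z) = 1 := fun z hz => by rw [hρB z hz, mul_zero, Real.exp_zero]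
  have hW : ∀ z ∈ Abar, Real.exp (1 / (4 * ((d : ℝ) + 2)) * r) ≤ Real.exp (1 / (4 * ((d : ℝ) + 2)) * ρ z) :=
    fun z hz => Real.exp_le_exp.2 (mul_le_mul_of_nonneg_left (hr z hz) hδ0)
  exact hs_restrict_lapSL_GpY_le i hG hC0 hC1 hreg hω (fun μ z => bondRatio_exp_le i hδ0 hδ1 μ z (hρ1 μ z))
    (fun μ z => bondRatio_exp_le' i hδ0 hδ1 μ z (hρ2 μ z)) (fun z w hzw => blockOsc_exp_le i hδ0 hδD z w (hρD z w hzw)) hδκ hΨ hΨA hωB hĀ hj₁ hjA hjB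
    (Real.exp_pos _) hW

end Main

end Literature.MathematicalPhysics.QuantumFieldTheory.Balaban1983to89.B9Thm31SiteLapGpDecayReg335Y
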